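import Literature.AnabelianGeometry.EtaleTheta.TemperedFrobenioidCor38Sub
import Literature.AnabelianGeometry.EtaleTheta.TemperedFrobenioidToy
import Literature.AlgebraicGeometry.Frobenioids.ArchimedeanPointBaseProp35
import Mathlib.CategoryTheory.Equivalence
import HarnessLib

/-!
# [EtTh] Def. 3.6 AS TYPED admits a tempered Frobenioid whose divisor monoid has a UNIT, and two tempered
# Frobenioids with one and the same category but different constant functions (toy data, part 1)

S. Mochizuki, *The étale theta function and its Frobenioid-theoretic manifestations*, Publ. RIMS **45** (2009)
[EtTh], Def. 3.6 (i)–(iv) PDF pp. 76–78 [cite: MochizukiEtTh2009, Def 3.6 p.77]; [FrdI] Thm. 5.2 (i) p. 100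
[cite: MochizukiFrdI2008, Thm. 5.2(i) p.100]. abc-iut cell, block F (fact-proving wave), seat abc-iut-f-135; DATA file
(toy definitions and their bookkeeping lemmas) behind the schema verdicts on the Cor. 3.8 sub-DAG rows C38-L07/L09/L10
(FACT-LIST F-2818, F-2821, F-2823; proofs in `TemperedFrobenioidCor38SubSchemaNegative.lean`). Pattern of
abc-iut-L2-t3's `TemperedFrobenioidToy.lean` (consistency witness of the typed interface), one notch richer.

WHAT IS BUILT, over the one-object base `D = D₀ = pt`, the trivial [FrdI] vocabularies `Toy.monoidVocab`/`Toy.catVocab`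
and abc-iut-L2-t3's Def. 3.3 (iii) toy data `Toy.divisorMonoids`: `UnitToy.realified F` / `UnitToy.frd F hF` — Def. 3.6
(i)/(ii) data with `Φ = Φ^{ℝ-log} = ℤ × ℕ`, so that `Φ` has the unit `n₀ = (1,0)` (the typed interface carries
"divisorial", hence "sharp", only as the FREE predicate `VD.IsDivisorialOn`), `B₀^Λ = ℤ` with `div(b) = (0, b)`,
`ℝ·Φ₀^cnst = 0 ⊕ ℤ` (root-closed), `Φ^{bs-fld} = 0 × ℕ` monoprime (REAL `IsMonoprime`), condition (b) REAL
(`div(1) = (0,1) ≠ 0`), and constant functions `F₀^Λ := F` a PARAMETER: `frdFull` (`F = ℤ`), `frdNat` (`F = ℕ`). Since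
`F₀^Λ` does not enter `TemperedFrobenioid.category`, `frdFull.category = frdNat.category` DEFINITIONALLY (`category_eq`,
`reflEquiv`, `hypRefl : Cor38Hyp frdFull frdNat` with `Ψ = 𝟭`; `D = pt` is of FSMFF-type — abc-iut-L1's
`ArchFrd.isOfFSMFFType_discretePUnit` —, "non-dilating" is the trivial vocabulary clause). Test objects of the hull of `frdNat`: `B0 = (•, 0)`, `B1 = (•, (0,1))`.
HONEST FRAMING: a degenerate inhabitant of the TYPED interface, not a tempered Frobenioid of a curve (print's `Φ` is a
divisorial, hence sharp, monoid); it says nothing about [EtTh] itself; nothing here bears on [IUTchIII] Cor. 3.12.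
-/

noncomputable section

namespace Literature.AnabelianGeometry.EtaleTheta

open CategoryTheory Opposite Literature.AlgebraicGeometry.Frobenioids

namespace UnitToy

/-! ## The data: `Φ₀^ℝ = ℤ × ℕ` (a monoid WITH UNITS), `B₀^Λ = ℤ`, `div b = (0, b)`, `ℝ·Φ₀^cnst = 0 ⊕ ℤ` -/

/-- The value monoid `Φ^{ℝ-log}(•) = ℤ × ℕ` (multiplicatively). [cite: MochizukiEtTh2009, Def 3.6 p.76] -/
abbrev M : Type := Multiplicative ℤ × Multiplicative ℕ

/-- The generator `(0, 1)` of the sharp part. [cite: MochizukiEtTh2009, Def 3.6 p.76] -/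
def x₁ : M := (1, Multiplicative.ofAdd 1)

/-- The unit `(1, 0)` of `Φ`. [cite: MochizukiEtTh2009, Def 3.6 p.76] -/
def n₀ : M := (Multiplicative.ofAdd 1, 1)

/-- Its inverse `(-1, 0)`. [cite: MochizukiEtTh2009, Def 3.6 p.76] -/
def n₀inv : M := (Multiplicative.ofAdd (-1), 1)

/-- First coordinate on the groupification: `(ℤ × ℕ)^gp → ℤ`. [cite: MochizukiEtTh2009, Def 3.6 p.76] -/
def fstR : Algebra.GrothendieckGroup M →* Multiplicative ℤ :=
  Algebra.GrothendieckGroup.lift (MonoidHom.fst _ _)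

/-- Second coordinate on the groupification: `(ℤ × ℕ)^gp → ℤ`. [cite: MochizukiEtTh2009, Def 3.6 p.76] -/
def sndR : Algebra.GrothendieckGroup M →* Multiplicative ℤ :=
  Algebra.GrothendieckGroup.lift
    ((AddMonoidHom.toMultiplicative (Nat.castAddMonoidHom ℤ)).comp (MonoidHom.snd _ _))

/-- `lift f (of a) = f a` (universal property of the groupification, [FrdI] §0). [cite: MochizukiFrdI2008, §0 p.11] -/
theorem lift_of {N : Type} [CommMonoid N] {G : Type} [CommGroup G] (f : N →* G) (a : N) :
    Algebra.GrothendieckGroup.lift f (Algebra.GrothendieckGroup.of a) = f a := by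
  have h := Algebra.GrothendieckGroup.lift.symm_apply_apply f
  rw [Algebra.GrothendieckGroup.lift_symm_apply] at h
  exact DFunLike.congr_fun h a

/-- `fst` on generators. [cite: MochizukiEtTh2009, Def 3.6 p.77] -/
@[simp] theorem fstR_of (a : M) : fstR (Algebra.GrothendieckGroup.of a) = a.1 := lift_of _ a

/-- `snd` on generators. [cite: MochizukiEtTh2009, Def 3.6 p.77] -/
@[simp] theorem sndR_of (a : M) :
    sndR (Algebra.GrothendieckGroup.of a) = Multiplicative.ofAdd ((Multiplicative.toAdd a.2 : ℕ) : ℤ) :=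
  lift_of _ a

/-- `fst (0,1) = 0`. [cite: MochizukiEtTh2009, Def 3.6 p.77] -/
@[simp] theorem fstR_of_x₁ : fstR (Algebra.GrothendieckGroup.of x₁) = 1 := by
  rw [fstR_of]; rfl

/-- `snd (0,1) = 1`. [cite: MochizukiEtTh2009, Def 3.6 p.77] -/
@[simp] theorem sndR_of_x₁ : sndR (Algebra.GrothendieckGroup.of x₁) = Multiplicative.ofAdd 1 := by
  rw [sndR_of]; rfl

/-- `gpMap id = id`, pointwise ([FrdI] §0 functoriality of `M ↦ M^gp`). [cite: MochizukiFrdI2008, §0 p.11] -/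
theorem gpMap_id_apply {N : Type} [CommMonoid N] (x : Algebra.GrothendieckGroup N) :
    gpMap (MonoidHom.id N) x = x :=
  DFunLike.congr_fun (Literature.AlgebraicGeometry.Frobenioids.gpMap_id (M := N)) x

/-- `div : B₀^Λ = ℤ → (ℤ × ℕ)^gp`, `b ↦ (0, b)`. [cite: MochizukiEtTh2009, Def 3.6 p.76] -/
def divHom : Multiplicative ℤ →* Algebra.GrothendieckGroup M :=
  zpowersHom _ (Algebra.GrothendieckGroup.of x₁)

/-- `div(b) = b · (0,1)`. [cite: MochizukiEtTh2009, Def 3.6 p.76] -/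
theorem divHom_apply (b : Multiplicative ℤ) :
    divHom b = Algebra.GrothendieckGroup.of x₁ ^ (Multiplicative.toAdd b) := rfl

/-- `fst (div b) = 0`. [cite: MochizukiEtTh2009, Def 3.6 p.76] -/
@[simp] theorem fstR_divHom (b : Multiplicative ℤ) : fstR (divHom b) = 1 := by
  rw [divHom_apply, map_zpow, fstR_of_x₁, one_zpow]

/-- `snd (div b) = b`. [cite: MochizukiEtTh2009, Def 3.6 p.76] -/
@[simp] theorem sndR_divHom (b : Multiplicative ℤ) : sndR (divHom b) = b := by
  rw [divHom_apply, map_zpow, sndR_of_x₁, ← ofAdd_zsmul, zsmul_eq_mul, mul_one, Int.cast_id, ofAdd_toAdd]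

/-- `ℝ·Φ₀^cnst := 0 ⊕ ℤ = Ker(fst)`. [cite: MochizukiEtTh2009, Def 3.6 p.76] -/
def cnstR : Subgroup (Algebra.GrothendieckGroup M) := fstR.ker

/-- `div(B₀^Λ) ⊆ ℝ·Φ₀^cnst`. [cite: MochizukiEtTh2009, Def 3.6 p.76] -/
theorem divHom_mem_cnstR (b : Multiplicative ℤ) : divHom b ∈ cnstR := by
  rw [cnstR, MonoidHom.mem_ker, fstR_divHom]

/-- `0 ⊕ ℤ` is root-closed in `(ℤ × ℕ)^gp` (torsion-freeness of `ℤ`). [cite: MochizukiEtTh2009, Def 3.6 p.76] -/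
theorem cnstR_root (g : Algebra.GrothendieckGroup M) (n : ℕ+) (hg : g ^ (n : ℕ) ∈ cnstR) : g ∈ cnstR := by
  rw [cnstR, MonoidHom.mem_ker] at hg ⊢
  rw [map_pow] at hg
  have h := congrArg Multiplicative.toAdd hg
  rw [toAdd_pow, toAdd_one, nsmul_eq_mul] at h
  have hn : ((n : ℕ) : ℤ) ≠ 0 := by exact_mod_cast n.ne_zero
  exact Multiplicative.toAdd.injective ((mul_eq_zero.mp h).resolve_left hn)

/-- `Φ₀ = ℕ → Φ₀^ℝ = ℤ × ℕ`, `n ↦ (0, n)`. [cite: MochizukiEtTh2009, Def 3.6 p.76] -/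
def toR : Multiplicative ℕ →* M := MonoidHom.inr _ _

/-- Compatibility of the two divisor maps along `Φ₀ → Φ₀^ℝ` (for `cnst_le_cnstR`). [cite: MochizukiEtTh2009, Def 3.6 p.76] -/
theorem gpMap_toR_divHom (b : Multiplicative ℤ) : gpMap toR (Toy.divHom b) = divHom b := by
  rw [Toy.divHom, zpowersHom_apply, map_zpow, gpMap_of, divHom_apply]
  rfl

/-- **Def 3.6 (i) data** with `Φ₀^ℝ = ℤ × ℕ`, `B₀^Λ = ℤ`, `div b = (0,b)`, `ℝ·Φ₀^cnst = 0 ⊕ ℤ` and constant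
functions `F₀^Λ := F` (a parameter), over the one-object base and the trivial vocabulary.
[cite: MochizukiEtTh2009, Def 3.6 p.76] -/
def realified (F : Submonoid (Multiplicative ℤ)) :
    RealifiedDivisorMonoids (D₀ := Discrete PUnit.{1}) Toy.monoidVocab where
  toDivisorMonoids := Toy.divisorMonoids
  Λ := MonoidType.Z
  ΦR := (Functor.const _).obj (CommMonCat.of M)
  toR _ := toR
  toR_natural _ _ := rfl
  isRealification _ := trivial
  BΛ := (Functor.const _).obj (CommMonCat.of (Multiplicative ℤ))
  isUnit_BΛ _ b := by
    change IsUnit (M := Multiplicative ℤ) b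
    exact Group.isUnit _
  divΛ _ := divHom
  divΛ_natural _ b := (gpMap_id_apply (divHom b)).symm
  FΛ _ := F
  FΛ_map _ _ hb := hb
  cnstR _ := cnstR
  cnstR_map _ x hx := by
    change gpMap (MonoidHom.id M) x ∈ cnstR
    rwa [gpMap_id_apply]
  divΛ_mem_cnstR _ b _ := divHom_mem_cnstR b
  cnstR_root _ g n hg := cnstR_root g n hg
  cnst_le_cnstR _ b _ := by
    change gpMap toR (Toy.divHom b) ∈ cnstR
    rw [gpMap_toR_divHom]
    exact divHom_mem_cnstR b
  ncspR _ := ⊤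
  cspR _ := ⊥
  toR_ncsp _ _ _ := trivial
  toR_csp _ x hx := by
    have hx' : x = 1 := Submonoid.mem_bot.mp hx
    subst hx'
    exact Submonoid.mem_bot.mpr (map_one toR)

/-- `Φ^{bs-fld}(•) = 0 × ℕ` is `ℤ`-monoprime. [cite: MochizukiEtTh2009, Def 3.6 p.77] -/
theorem isMonoprime_bs :
    IsMonoprime ↥((⊤ : Submonoid M) ⊓ cnstR.toSubmonoid.comap Algebra.GrothendieckGroup.of) := by
  refine IsMonoprime.ofZ ⟨⟨?_⟩⟩
  refine
    { toFun := fun s => s.1.2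
      invFun := fun n => ⟨(1, n), Submonoid.mem_inf.2 ⟨Submonoid.mem_top _, ?_⟩⟩
      left_inv := ?_
      right_inv := fun _ => rfl
      map_mul' := fun _ _ => rfl }
  · rw [Submonoid.mem_comap, Subgroup.mem_toSubmonoid, cnstR, MonoidHom.mem_ker, fstR_of]
  · intro s
    have hs : fstR (Algebra.GrothendieckGroup.of s.1) = 1 := (Submonoid.mem_inf.1 s.2).2
    rw [fstR_of] at hs
    exact Subtype.ext (Prod.ext hs.symm rfl)

/-- `(0,1) ≠ 0`. [cite: MochizukiEtTh2009, Def 3.6 p.77] -/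
theorem x₁_ne_one : x₁ ≠ 1 := by
  intro h
  have := congrArg (fun p : M => Multiplicative.toAdd p.2) h
  simp [x₁] at this

/-- **Def 3.6 (ii), the inhabitant**: `D = D₀ = pt`, `Φ = Φ^{ℝ-log} = ℤ × ℕ` (group-saturated trivially; its
`Φ^{bs-fld} = 0 × ℕ` monoprime), `(b)`: `div(1) = (0,1) = x₁/1` with `x₁ ≠ 1`. [cite: MochizukiEtTh2009, Def 3.6 p.77] -/
def frd (F : Submonoid (Multiplicative ℤ)) (hF : Multiplicative.ofAdd (1 : ℤ) ∈ F) :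
    TemperedFrobenioid (realified F) (Discrete PUnit.{1}) Toy.catVocab where
  isConnected := Toy.temperedFrobenioid.isConnected
  isTotallyEpimorphic := Toy.temperedFrobenioid.isTotallyEpimorphic
  base := 𝟭 _
  Φ := ⟨fun _ => ⊤, fun _ _ _ => trivial⟩
  isGroupSaturated A := (isGroupSaturated_iff' _).2 fun _ _ _ _ _ _ => trivial
  isPerfFactorial _ := trivial
  isDivisorialOn := trivial
  isMonoprime_bsFld _ := isMonoprime_bs
  exists_FΛ_div_ne _ := ⟨Multiplicative.ofAdd (1 : ℤ), hF, x₁, trivial, 1, trivial, x₁_ne_one, by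
    change divHom (Multiplicative.ofAdd (1 : ℤ)) = _
    rw [divHom_apply, toAdd_ofAdd, zpow_one, map_one, div_one]
    rfl⟩

/-- `F₀^Λ = ℤ` (all of `B₀^Λ`). [cite: MochizukiEtTh2009, Def 3.6 p.77] -/
abbrev frdFull : TemperedFrobenioid (realified ⊤) (Discrete PUnit.{1}) Toy.catVocab :=
  frd ⊤ (Submonoid.mem_top _)

/-- The constant functions `ℕ ⊆ ℤ = B₀^Λ` (nonnegative powers of the generator). [cite: MochizukiEtTh2009, Def 3.6 p.76] -/
def natPowers : Submonoid (Multiplicative ℤ) := Submonoid.powers (Multiplicative.ofAdd (1 : ℤ))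

/-- `1 ∈ ℕ`. [cite: MochizukiEtTh2009, Def 3.6 p.77] -/
theorem one_mem_natPowers : Multiplicative.ofAdd (1 : ℤ) ∈ natPowers := Submonoid.mem_powers _

/-- `F₀^Λ = ℕ ⊆ ℤ`. [cite: MochizukiEtTh2009, Def 3.6 p.77] -/
abbrev frdNat : TemperedFrobenioid (realified natPowers) (Discrete PUnit.{1}) Toy.catVocab :=
  frd natPowers one_mem_natPowers

/-- The two structures have the SAME underlying category (`F₀^Λ` does not enter `category`). [cite: MochizukiEtTh2009, Def 3.6 p.77] -/
theorem category_eq : frdFull.category = frdNat.category := rfl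

/-- Hence the identity equivalence between them. [cite: MochizukiEtTh2009, Cor 3.8 p.80] -/
def reflEquiv : frdFull.category ≌ frdNat.category := CategoryTheory.Equivalence.refl

/-! ## Bookkeeping on the two structures -/

/-- The one object of the base. [cite: MochizukiEtTh2009, Def 3.6 p.76] -/
abbrev pt : Discrete PUnit.{1} := ⟨⟨⟩⟩

/-- Membership in `Φ^{bs-fld}(•) = 0 × ℕ`. [cite: MochizukiEtTh2009, Def 3.6 p.77] -/
theorem mem_bs_iff (F : Submonoid (Multiplicative ℤ)) (hF : Multiplicative.ofAdd (1 : ℤ) ∈ F)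
    (A : (Discrete PUnit.{1})ᵒᵖ) (x : M) : x ∈ (frd F hF).bsFld.carrier A ↔ x.1 = 1 := by
  change x ∈ (⊤ : Submonoid M) ⊓ cnstR.toSubmonoid.comap Algebra.GrothendieckGroup.of ↔ _
  rw [Submonoid.mem_inf, Submonoid.mem_comap, Subgroup.mem_toSubmonoid, cnstR, MonoidHom.mem_ker, fstR_of]
  exact ⟨fun h => h.2, fun h => ⟨Submonoid.mem_top _, h⟩⟩

/-- The zero object `(•, 0)` of the hull of `frdNat`. [cite: MochizukiEtTh2009, Def 3.6 p.78] -/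
abbrev B0 : frdNat.hullCategory := ⟨pt, 1⟩

/-- `x₁ = (0, 1) ∈ Φ^{bs-fld}(•)`. [cite: MochizukiEtTh2009, Def 3.6 p.77] -/
def n₁bs : ↥(frdNat.bsFld.carrier (op pt)) := ⟨x₁, (mem_bs_iff _ _ _ x₁).2 rfl⟩

/-- The object `(•, x₁)` of the hull of `frdNat`. [cite: MochizukiEtTh2009, Def 3.6 p.78] -/
abbrev B1 : frdNat.hullCategory := ⟨pt, Algebra.GrothendieckGroup.of n₁bs⟩

/-- **The data of Cor. 3.8 AS TYPED, identity witness**: `C₁ = frdFull`, `C₂ = frdNat` (same category), `Ψ = 𝟭`.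
[cite: MochizukiEtTh2009, Cor 3.8 p.80] -/
def hypRefl : Cor38Hyp frdFull frdNat :=
  ⟨reflEquiv, ⟨ArchFrd.isOfFSMFFType_discretePUnit, ArchFrd.isOfFSMFFType_discretePUnit⟩,
    ⟨fun _ _ => trivial, fun _ _ => trivial⟩⟩

end UnitToy

end Literature.AnabelianGeometry.EtaleTheta

end
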